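import Summits.QuantumFields.YangMills.Theorems.SwapVirialDeficitGnomonicJetFourLetters
import Summits.QuantumFields.YangMills.Theorems.SwapVirialDeficitGnomonicJetLeaders
import HarnessLib

/-!
# W4 (order-4 jets), part K3: THE GNOMONIC LETTERS, THE SLAVED LETTER, THE LEADERS AND THE FOLLOWERS CARRY 4-JETS
# (free-hands support of ⟨stmt-QuantumFields-24197⟩ `SwapVirialDeficit.SwapGluedStiffness`)

Order-four twin of ✓`…GnomonicJetLeaders` (J2b), for LEAD g97's brick W4 (steep-window Morse–Bott §1 (B-bulk): jets to order 4 along Euler rays), built on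
✓`…GnomonicJetFour` (K1: the product-closed 4-jet package `(a, a², 3a³, 9a⁴)`) and ✓`…GnomonicJetFourLetters` (K2: ★★★ `jet4_radialUnit_affine`):
* §1 ★★ `jet4_trDilLetter` (`x, y` letters: size `τ(v) = √((v₁²+v₂²)/(1+v₀²))`), ★★ `jet4_smulLetter` (`z` ∕ followers: size `√(Σ vᵢ²)`);
* §2 ★★ `jet4_slavedLetter` (`Ā·x̂(t)·A·ẑ(t)`: size `τ(vx) + √(Σ vzᵢ²)`);
* §3 ★★★ `jet4_leader` ∕ `jet4_leader_blowUpPoint` (every leader of `blowUpPoint t (gnomonicPoint a ε η)`, `a ≠ 0`, carries a 4-jet of size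
  `τ(η.1.1) + τ(η.1.2) + √(Σ (η.2.1)ₖ²)`), ★★ `jet4_follower` (size `√(Σ (η.2.2 i)ₖ²)`).
The orthogonality ∕ size identities (`inner_axial_transverse`, `norm_transverse_div_norm_axial`, …) are J2b's.

HONEST LABEL: calculus plumbing (no ring functional, no measure); nothing about ⟨24197⟩ (window-uniform, OPEN), (LW), (M), W3–W9 or any rung is proved; ⟨24194⟩ ∕
⟨24196⟩ ∕ ⟨24497⟩ OPEN; item of record ⟨24085⟩ SubOctaveBounded aside ∕ untouched; the Yang–Mills mass gap is NOT proved; no summit is proved by a line.  THEOREMS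
ONLY (0 `def`, 0 `sorry`), standard axioms, no local instances.  Seat ym-line-fcl-p3 g47 (cell ym-idea-1, free hands), `--supports stmt-QuantumFields-24197`.
References: [folklore].
-/

set_option autoImplicit false

noncomputable section

open Quaternion
open scoped Quaternion RealInnerProductSpace BigOperators
open Literature.MathematicalPhysics.QuantumLattice
open Literature.Analysis.Calculus (radialUnit radialUnit_def norm_radialUnit)
open Summit.QuantumFields.YangMills.Theorems.SwapTwistDeficit.ToronLog (axisPoint)
open Summit.QuantumFields.YangMills.Theorems.SwapVirialDeficit.ZeroModeSigma (su2Quat_quatToSU2_eq_radialUnit slaveP norm_axisUnit dil3 dil3_apply)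
open Summit.QuantumFields.YangMills.Theorems.SwapVirialDeficit.BlowUp (leaderTuple)
open Summit.QuantumFields.YangMills.Theorems.SwapVirialDeficit.BlowUpRing (gnoLetter gnoSign gnoLetter_eq gnoLetter_ne_zero trDil
  dilate_gnoLetter dilateIm_gnoLetter)

namespace Summit.QuantumFields.YangMills.Theorems.SwapVirialDeficit.Gnomonic

/-! ## §1 The free letters `x, y, z` and the followers -/

/-- ★★ **THE `x, y` LETTERS** `t ↦ su2Quat (quatToSU2 (gnoLetter ε (trDil t v)))` carry a 4-jet of size `τ(v) = √((v₁² + v₂²)/(1 + v₀²))`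
(so that `gnoWtr v = 4τ²/(1+τ²)`). [folklore] -/
theorem jet4_trDilLetter (ε : Bool) (v : Fin 3 → ℝ) :
    ∃ f₁ f₂ f₃ f₄ : ℝ → ℍ, (∀ t, HasDerivAt (fun t : ℝ => su2Quat (quatToSU2 (gnoLetter ε (trDil t v)))) (f₁ t) t) ∧ (∀ t, HasDerivAt f₁ (f₂ t) t) ∧
      (∀ t, HasDerivAt f₂ (f₃ t) t) ∧ (∀ t, HasDerivAt f₃ (f₄ t) t) ∧
      ∀ t, ‖su2Quat (quatToSU2 (gnoLetter ε (trDil t v)))‖ ≤ 1 ∧ ‖f₁ t‖ ≤ Real.sqrt ((v 1 ^ 2 + v 2 ^ 2) / (1 + v 0 ^ 2)) ∧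
        ‖f₂ t‖ ≤ Real.sqrt ((v 1 ^ 2 + v 2 ^ 2) / (1 + v 0 ^ 2)) ^ 2 ∧ ‖f₃ t‖ ≤ 3 * Real.sqrt ((v 1 ^ 2 + v 2 ^ 2) / (1 + v 0 ^ 2)) ^ 3 ∧
        ‖f₄ t‖ ≤ 9 * Real.sqrt ((v 1 ^ 2 + v 2 ^ 2) / (1 + v 0 ^ 2)) ^ 4 := by
  have h := jet4_smul (abs_gnoSign ε) (jet4_radialUnit_affine (gnomonicQuat_ne_zero ![v 0, 0, 0]) (inner_axial_transverse v))
  have e : ∀ t : ℝ, gnoSign ε • radialUnit (gnomonicQuat ![v 0, 0, 0] + t • (gnomonicQuat v - gnomonicQuat ![v 0, 0, 0])) =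
      su2Quat (quatToSU2 (gnoLetter ε (trDil t v))) := fun t => by
    rw [gnoLetter_eq, su2Quat_quatToSU2_smul_gnomonicQuat (abs_gnoSign ε), gnomonicQuat_trDil]
  simpa only [e, norm_transverse_div_norm_axial] using h

/-- ★★ **THE `z` ∕ FOLLOWER LETTERS** `t ↦ su2Quat (quatToSU2 (gnoLetter ε (t • v)))` carry a 4-jet of size `√(Σ vᵢ²)`. [folklore] -/
theorem jet4_smulLetter (ε : Bool) (v : Fin 3 → ℝ) :
    ∃ f₁ f₂ f₃ f₄ : ℝ → ℍ, (∀ t, HasDerivAt (fun t : ℝ => su2Quat (quatToSU2 (gnoLetter ε (t • v)))) (f₁ t) t) ∧ (∀ t, HasDerivAt f₁ (f₂ t) t) ∧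
      (∀ t, HasDerivAt f₂ (f₃ t) t) ∧ (∀ t, HasDerivAt f₃ (f₄ t) t) ∧
      ∀ t, ‖su2Quat (quatToSU2 (gnoLetter ε (t • v)))‖ ≤ 1 ∧ ‖f₁ t‖ ≤ Real.sqrt (∑ i, v i ^ 2) ∧
        ‖f₂ t‖ ≤ Real.sqrt (∑ i, v i ^ 2) ^ 2 ∧ ‖f₃ t‖ ≤ 3 * Real.sqrt (∑ i, v i ^ 2) ^ 3 ∧
        ‖f₄ t‖ ≤ 9 * Real.sqrt (∑ i, v i ^ 2) ^ 4 := by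
  have h := jet4_smul (abs_gnoSign ε) (jet4_radialUnit_affine (one_ne_zero : (1 : ℍ) ≠ 0) (inner_one_gnomonicQuat_sub_one v))
  have e : ∀ t : ℝ, gnoSign ε • radialUnit ((1 : ℍ) + t • (gnomonicQuat v - 1)) = su2Quat (quatToSU2 (gnoLetter ε (t • v))) := fun t => by
    rw [gnoLetter_eq, su2Quat_quatToSU2_smul_gnomonicQuat (abs_gnoSign ε), gnomonicQuat_smul]
  simpa only [e, norm_gnomonicQuat_sub_one] using h

/-! ## §2 The slaved letter -/

/-- ★★ **THE SLAVED LETTER** `t ↦ su2Quat (quatToSU2 (slaveP A (gnoLetter εx (trDil t vx)) · gnoLetter εz (t • vz))) = Ā·x̂(t)·A·ẑ(t)` (`‖A‖ = 1`)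
carries a 4-jet of size `τ(vx) + √(Σ vzᵢ²)` (✓`su2Quat_quatToSU2_slaveP_mul`, `jet4_mul` with two constants). [folklore] -/
theorem jet4_slavedLetter {A : ℍ} (hA : ‖A‖ = 1) (εx εz : Bool) (vx vz : Fin 3 → ℝ) :
    ∃ f₁ f₂ f₃ f₄ : ℝ → ℍ,
      (∀ t, HasDerivAt (fun t : ℝ => su2Quat (quatToSU2 (slaveP A (gnoLetter εx (trDil t vx)) * gnoLetter εz (t • vz)))) (f₁ t) t) ∧
      (∀ t, HasDerivAt f₁ (f₂ t) t) ∧ (∀ t, HasDerivAt f₂ (f₃ t) t) ∧ (∀ t, HasDerivAt f₃ (f₄ t) t) ∧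
      ∀ t, ‖su2Quat (quatToSU2 (slaveP A (gnoLetter εx (trDil t vx)) * gnoLetter εz (t • vz)))‖ ≤ 1 ∧
        ‖f₁ t‖ ≤ Real.sqrt ((vx 1 ^ 2 + vx 2 ^ 2) / (1 + vx 0 ^ 2)) + Real.sqrt (∑ i, vz i ^ 2) ∧
        ‖f₂ t‖ ≤ (Real.sqrt ((vx 1 ^ 2 + vx 2 ^ 2) / (1 + vx 0 ^ 2)) + Real.sqrt (∑ i, vz i ^ 2)) ^ 2 ∧
        ‖f₃ t‖ ≤ 3 * (Real.sqrt ((vx 1 ^ 2 + vx 2 ^ 2) / (1 + vx 0 ^ 2)) + Real.sqrt (∑ i, vz i ^ 2)) ^ 3 ∧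
        ‖f₄ t‖ ≤ 9 * (Real.sqrt ((vx 1 ^ 2 + vx 2 ^ 2) / (1 + vx 0 ^ 2)) + Real.sqrt (∑ i, vz i ^ 2)) ^ 4 := by
  have hτ : 0 ≤ Real.sqrt ((vx 1 ^ 2 + vx 2 ^ 2) / (1 + vx 0 ^ 2)) := Real.sqrt_nonneg _
  have hζ : 0 ≤ Real.sqrt (∑ i, vz i ^ 2) := Real.sqrt_nonneg _
  have h1 := jet4_mul le_rfl hτ (jet4_const (star A) (by rw [Quaternion.norm_star, hA]) le_rfl) (jet4_trDilLetter εx vx)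
  have h2 := jet4_mul (by positivity) le_rfl h1 (jet4_const A hA.le le_rfl)
  have h3 := jet4_mul (by positivity) hζ h2 (jet4_smulLetter εz vz)
  have e : ∀ t : ℝ, star A * su2Quat (quatToSU2 (gnoLetter εx (trDil t vx))) * A * su2Quat (quatToSU2 (gnoLetter εz (t • vz))) =
      su2Quat (quatToSU2 (slaveP A (gnoLetter εx (trDil t vx)) * gnoLetter εz (t • vz))) := fun t =>
    (su2Quat_quatToSU2_slaveP_mul hA (gnoLetter_ne_zero _ _) (gnoLetter_ne_zero _ _)).symm
  simpa only [e, zero_add, add_zero] using h3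

/-! ## §3 Along the blow-up: every leader and every follower quaternion carries a 4-jet -/

/-- ★★★ **LEADER JETS**: for a hub `a ≠ 0`, each of the four leader quaternions `su2Quat (leaderTuple a (dil3 t ((X, Y), Z)) μ)` of the gnomonic
blow-up (`X = gnoLetter εx vx`, …) carries, as a function of the LINEAR blow-up parameter `t`, a 4-jet of size `S = τ(vx) + τ(vy) + √(Σ vzᵢ²)`
(`C₀`: `τ(vx)`; `C₁` slaved: `τ(vx) + √(Σ vzᵢ²)`; `C₂`: `τ(vy)`; the hub `C₃` is constant). [folklore] -/
theorem jet4_leader {a : ℍ} (ha : a ≠ 0) (εx εy εz : Bool) (vx vy vz : Fin 3 → ℝ) (μ : Fin 4) :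
    ∃ f₁ f₂ f₃ f₄ : ℝ → ℍ,
      (∀ t, HasDerivAt (fun t : ℝ => su2Quat (leaderTuple a (dil3 t ((gnoLetter εx vx, gnoLetter εy vy), gnoLetter εz vz)) μ)) (f₁ t) t) ∧
      (∀ t, HasDerivAt f₁ (f₂ t) t) ∧ (∀ t, HasDerivAt f₂ (f₃ t) t) ∧ (∀ t, HasDerivAt f₃ (f₄ t) t) ∧
      ∀ t, ‖su2Quat (leaderTuple a (dil3 t ((gnoLetter εx vx, gnoLetter εy vy), gnoLetter εz vz)) μ)‖ ≤ 1 ∧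
        ‖f₁ t‖ ≤ Real.sqrt ((vx 1 ^ 2 + vx 2 ^ 2) / (1 + vx 0 ^ 2)) + Real.sqrt ((vy 1 ^ 2 + vy 2 ^ 2) / (1 + vy 0 ^ 2)) + Real.sqrt (∑ i, vz i ^ 2) ∧
        ‖f₂ t‖ ≤ (Real.sqrt ((vx 1 ^ 2 + vx 2 ^ 2) / (1 + vx 0 ^ 2)) + Real.sqrt ((vy 1 ^ 2 + vy 2 ^ 2) / (1 + vy 0 ^ 2)) +
          Real.sqrt (∑ i, vz i ^ 2)) ^ 2 ∧
        ‖f₃ t‖ ≤ 3 * (Real.sqrt ((vx 1 ^ 2 + vx 2 ^ 2) / (1 + vx 0 ^ 2)) + Real.sqrt ((vy 1 ^ 2 + vy 2 ^ 2) / (1 + vy 0 ^ 2)) +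
          Real.sqrt (∑ i, vz i ^ 2)) ^ 3 ∧
        ‖f₄ t‖ ≤ 9 * (Real.sqrt ((vx 1 ^ 2 + vx 2 ^ 2) / (1 + vx 0 ^ 2)) + Real.sqrt ((vy 1 ^ 2 + vy 2 ^ 2) / (1 + vy 0 ^ 2)) +
          Real.sqrt (∑ i, vz i ^ 2)) ^ 4 := by
  have hτx : 0 ≤ Real.sqrt ((vx 1 ^ 2 + vx 2 ^ 2) / (1 + vx 0 ^ 2)) := Real.sqrt_nonneg _
  have hτy : 0 ≤ Real.sqrt ((vy 1 ^ 2 + vy 2 ^ 2) / (1 + vy 0 ^ 2)) := Real.sqrt_nonneg _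
  have hζ : 0 ≤ Real.sqrt (∑ i, vz i ^ 2) := Real.sqrt_nonneg _
  match μ with
  | ⟨0, _⟩ =>
    have e : ∀ t : ℝ, su2Quat (quatToSU2 (gnoLetter εx (trDil t vx))) =
        su2Quat (leaderTuple a (dil3 t ((gnoLetter εx vx, gnoLetter εy vy), gnoLetter εz vz)) ⟨0, by omega⟩) := fun t => by
      rw [show (⟨0, by omega⟩ : Fin 4) = 0 from rfl, (BlowUp.leaderTuple_apply _ _).1, dil3_apply]; simp only [dilate_gnoLetter]
    have h := jet4_mono hτx (show _ ≤ Real.sqrt ((vx 1 ^ 2 + vx 2 ^ 2) / (1 + vx 0 ^ 2)) + Real.sqrt ((vy 1 ^ 2 + vy 2 ^ 2) / (1 + vy 0 ^ 2)) +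
      Real.sqrt (∑ i, vz i ^ 2) by linarith) (jet4_trDilLetter εx vx)
    simpa only [e] using h
  | ⟨1, _⟩ =>
    have e : ∀ t : ℝ, su2Quat (quatToSU2 (slaveP (radialUnit (axisPoint a)) (gnoLetter εx (trDil t vx)) * gnoLetter εz (t • vz))) =
        su2Quat (leaderTuple a (dil3 t ((gnoLetter εx vx, gnoLetter εy vy), gnoLetter εz vz)) ⟨1, by omega⟩) := fun t => by
      rw [show (⟨1, by omega⟩ : Fin 4) = 1 from rfl, (BlowUp.leaderTuple_apply _ _).2.1, dil3_apply]
      simp only [dilate_gnoLetter, dilateIm_gnoLetter]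
    have h := jet4_mono (add_nonneg hτx hζ) (show _ ≤ Real.sqrt ((vx 1 ^ 2 + vx 2 ^ 2) / (1 + vx 0 ^ 2)) +
      Real.sqrt ((vy 1 ^ 2 + vy 2 ^ 2) / (1 + vy 0 ^ 2)) + Real.sqrt (∑ i, vz i ^ 2) by linarith) (jet4_slavedLetter (norm_axisUnit ha) εx εz vx vz)
    simpa only [e] using h
  | ⟨2, _⟩ =>
    have e : ∀ t : ℝ, su2Quat (quatToSU2 (gnoLetter εy (trDil t vy))) =
        su2Quat (leaderTuple a (dil3 t ((gnoLetter εx vx, gnoLetter εy vy), gnoLetter εz vz)) ⟨2, by omega⟩) := fun t => by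
      rw [show (⟨2, by omega⟩ : Fin 4) = 2 from rfl, (BlowUp.leaderTuple_apply _ _).2.2.1, dil3_apply]; simp only [dilate_gnoLetter]
    have h := jet4_mono hτy (show _ ≤ Real.sqrt ((vx 1 ^ 2 + vx 2 ^ 2) / (1 + vx 0 ^ 2)) + Real.sqrt ((vy 1 ^ 2 + vy 2 ^ 2) / (1 + vy 0 ^ 2)) +
      Real.sqrt (∑ i, vz i ^ 2) by linarith) (jet4_trDilLetter εy vy)
    simpa only [e] using h
  | ⟨3, _⟩ =>
    have e : ∀ t : ℝ, su2Quat (leaderTuple a (dil3 t ((gnoLetter εx vx, gnoLetter εy vy), gnoLetter εz vz)) ⟨3, by omega⟩) = radialUnit (axisPoint a) :=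
      fun t => by rw [show (⟨3, by omega⟩ : Fin 4) = 3 from rfl, (BlowUp.leaderTuple_apply _ _).2.2.2]; exact su2Quat_quatToSU2_axisUnit ha
    simp only [e]
    exact jet4_const (radialUnit (axisPoint a)) (norm_axisUnit ha).le (show 0 ≤ Real.sqrt ((vx 1 ^ 2 + vx 2 ^ 2) / (1 + vx 0 ^ 2)) +
      Real.sqrt ((vy 1 ^ 2 + vy 2 ^ 2) / (1 + vy 0 ^ 2)) + Real.sqrt (∑ i, vz i ^ 2) by positivity)

/-- ★★ **FOLLOWER JETS**: along `t ↦ blowUpPoint t (gnomonicPoint a ε η)` the follower quaternion `i` is `su2Quat (quatToSU2 (gnoLetter εᵢ (t • ηᵢ)))`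
(✓`dilateIm_gnoLetter`) and carries a 4-jet of size `√(Σ_k (ηᵢ)_k²)`. [folklore] -/
theorem jet4_follower {L : ℕ} (a : ℍ) (ε : BlowUpRing.GnoSign L) (η : BlowUpRing.GnoCoord L) (i : BlowUpRing.Fol L) :
    ∃ f₁ f₂ f₃ f₄ : ℝ → ℍ,
      (∀ t, HasDerivAt (fun t : ℝ => su2Quat ((BlowUpRing.blowUpPoint (L := L) t (BlowUpRing.gnomonicPoint a ε η)).2 i)) (f₁ t) t) ∧
      (∀ t, HasDerivAt f₁ (f₂ t) t) ∧ (∀ t, HasDerivAt f₂ (f₃ t) t) ∧ (∀ t, HasDerivAt f₃ (f₄ t) t) ∧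
      ∀ t, ‖su2Quat ((BlowUpRing.blowUpPoint (L := L) t (BlowUpRing.gnomonicPoint a ε η)).2 i)‖ ≤ 1 ∧
        ‖f₁ t‖ ≤ Real.sqrt (∑ k, η.2.2 i k ^ 2) ∧ ‖f₂ t‖ ≤ Real.sqrt (∑ k, η.2.2 i k ^ 2) ^ 2 ∧ ‖f₃ t‖ ≤ 3 * Real.sqrt (∑ k, η.2.2 i k ^ 2) ^ 3 ∧
        ‖f₄ t‖ ≤ 9 * Real.sqrt (∑ k, η.2.2 i k ^ 2) ^ 4 := by
  have e : ∀ t : ℝ, su2Quat (quatToSU2 (gnoLetter (ε.2.2 i) (t • η.2.2 i))) = su2Quat ((BlowUpRing.blowUpPoint (L := L) t (BlowUpRing.gnomonicPoint a ε η)).2 i) :=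
    fun t => by
      show _ = su2Quat (quatToSU2 (ZeroModeSigma.dilateIm t (gnoLetter (ε.2.2 i) (η.2.2 i))))
      rw [dilateIm_gnoLetter]
  have h := jet4_smulLetter (ε.2.2 i) (η.2.2 i)
  simpa only [e] using h

/-- ★★ **LEADER JETS along the blow-up point**: `su2Quat ((blowUpPoint t (gnomonicPoint a ε η)).1 μ)` carries a 4-jet of size
`τ(η.1.1) + τ(η.1.2) + √(Σ (η.2.1)ₖ²)` (`a ≠ 0`). [folklore] -/
theorem jet4_leader_blowUpPoint {L : ℕ} {a : ℍ} (ha : a ≠ 0) (ε : BlowUpRing.GnoSign L) (η : BlowUpRing.GnoCoord L) (μ : Fin 4) :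
    ∃ f₁ f₂ f₃ f₄ : ℝ → ℍ,
      (∀ t, HasDerivAt (fun t : ℝ => su2Quat ((BlowUpRing.blowUpPoint (L := L) t (BlowUpRing.gnomonicPoint a ε η)).1 μ)) (f₁ t) t) ∧
      (∀ t, HasDerivAt f₁ (f₂ t) t) ∧ (∀ t, HasDerivAt f₂ (f₃ t) t) ∧ (∀ t, HasDerivAt f₃ (f₄ t) t) ∧
      ∀ t, ‖su2Quat ((BlowUpRing.blowUpPoint (L := L) t (BlowUpRing.gnomonicPoint a ε η)).1 μ)‖ ≤ 1 ∧
        ‖f₁ t‖ ≤ Real.sqrt ((η.1.1 1 ^ 2 + η.1.1 2 ^ 2) / (1 + η.1.1 0 ^ 2)) + Real.sqrt ((η.1.2 1 ^ 2 + η.1.2 2 ^ 2) / (1 + η.1.2 0 ^ 2)) +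
          Real.sqrt (∑ k, η.2.1 k ^ 2) ∧
        ‖f₂ t‖ ≤ (Real.sqrt ((η.1.1 1 ^ 2 + η.1.1 2 ^ 2) / (1 + η.1.1 0 ^ 2)) + Real.sqrt ((η.1.2 1 ^ 2 + η.1.2 2 ^ 2) / (1 + η.1.2 0 ^ 2)) +
          Real.sqrt (∑ k, η.2.1 k ^ 2)) ^ 2 ∧
        ‖f₃ t‖ ≤ 3 * (Real.sqrt ((η.1.1 1 ^ 2 + η.1.1 2 ^ 2) / (1 + η.1.1 0 ^ 2)) + Real.sqrt ((η.1.2 1 ^ 2 + η.1.2 2 ^ 2) / (1 + η.1.2 0 ^ 2)) +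
          Real.sqrt (∑ k, η.2.1 k ^ 2)) ^ 3 ∧
        ‖f₄ t‖ ≤ 9 * (Real.sqrt ((η.1.1 1 ^ 2 + η.1.1 2 ^ 2) / (1 + η.1.1 0 ^ 2)) + Real.sqrt ((η.1.2 1 ^ 2 + η.1.2 2 ^ 2) / (1 + η.1.2 0 ^ 2)) +
          Real.sqrt (∑ k, η.2.1 k ^ 2)) ^ 4 :=
  jet4_leader ha ε.1.1 ε.1.2 ε.2.1 η.1.1 η.1.2 η.2.1 μ

end Summit.QuantumFields.YangMills.Theorems.SwapVirialDeficit.Gnomonic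

end
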